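import Summits.HodgeConjecture.HodgeConjecture.Theorems.SignSymmetricPowersSignDeckHodge

/-!
# K1-B eigen-Hodge numbers of the sign involution from the KERNEL form of the residue theorem
# (route `SignSymmetricPowers`, item stmt-HodgeConjecture-19716)

Sequel of `SignSymmetricPowersSignDeckHodge` (the registered stub `stub_signDeckHodge` of the K1-B line
`andre-zariski` v6, skeleton `321786b0b42d6049`, whose antecedent is the dimension-form named fact
`voisin2003_finrank_eigenspace_inf_hodgePiece_of_diagonalStabilizer`). The tree carries a second,
overlapping named fact for the same piece of Griffiths–Voisin residue theory, the kernel form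
`Griffiths1969_residueKernel_eq_jacobianIdeal` (Voisin II Thm. 6.10; file
`DiagonalSymmetryEigenHodgeNumbers`, where the odd-dimensional dimension statement
`finrank_signEigenspace_inf_piece_eq_of_residueKernel` is PROVED). This file proves the stub's
conclusion from the kernel form (`stub_signDeckHodge_of_residueKernel`, otherwise the registered
signature verbatim), so that the planner may bind both K1 lines (`CyclicUnitaryPowers`,
`SignSymmetricPowers`) to ONE fact. Landed `--supports stmt-HodgeConjecture-19716`; sorry-free.

## Proof

Below the Jacobian range (`(q+1)d < 5`) the piece vanishes
(`finrank_signEigenspace_inf_piece_eq_zero_of_lt`). Otherwise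
`finrank_signEigenspace_inf_piece_eq_of_residueKernel` gives the eigen-Hodge number as the
`(−1)^j`-refined Hilbert function of `R_f` for the twisted action `T_ι = (∏ ιᵢ) · (P ↦ P(ι • x))`;
`∏ ιᵢ = 1`, and the refined Hilbert function is the line's fold by the factored core
`hilbertSign_jacobianIdeal_signInvolution_eq` (sign-refined Macaulay theorem
`hilbertSign_jacobianIdeal_eq_card` + the combinatorics of the first file).

## References

* C. Voisin, *Hodge Theory and Complex Algebraic Geometry II* (2003), §6.1.3 Thm. 6.10 / Cor. 6.12.
  [cite: VoisinHodgeII2003]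
* J. Carlson, S. Müller-Stach, C. Peters, *Period Mappings and Period Domains* (2017), §7.4 Thm. 7.4.1.
  [cite: CarlsonMullerStachPeters2017]
-/

noncomputable section

open Finset MvPolynomial
open Literature.RingTheory.MvPolynomial Literature.AlgebraicGeometry.Motives Literature.AlgebraicGeometry.HodgeTheory
open Summit.HodgeConjecture.HodgeConjecture.Theorems.SignSymmetricPowersSignDeckHodge

namespace Summit.HodgeConjecture.HodgeConjecture.Theorems.SignSymmetricPowersSignDeckHodgeKernel

/-! ### §1 The `ι`-refined Hilbert function of the Jacobian ring is the line's fold -/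

/-- The twisted action of `ι` is the plain substitution `P ↦ P(ι • x)` (`∏ ιᵢ = 1`).
[cite: VoisinHodgeII2003, §6.1.3 (held text chunk p0159)] -/
theorem twistedDiagonalAction_signInvolutionVector :
    twistedDiagonalAction signInvolutionVector =
      (aeval (diagonalSubst signInvolutionVector)).toLinearMap := by
  unfold twistedDiagonalAction
  rw [prod_signInvolutionVector, one_smul]

section Kernel

variable (pm : List (ℕ × ℕ) → List (ℕ × ℕ) → List (ℕ × ℕ))
  (hpm : ∀ a b, pm a b = (List.range (a.length + b.length - 1)).map fun k =>
    (((List.range (k + 1)).map fun i =>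
        (a.getD i (0, 0)).1 * (b.getD (k - i) (0, 0)).1 + (a.getD i (0, 0)).2 * (b.getD (k - i) (0, 0)).2).sum,
     ((List.range (k + 1)).map fun i =>
        (a.getD i (0, 0)).1 * (b.getD (k - i) (0, 0)).2 + (a.getD i (0, 0)).2 * (b.getD (k - i) (0, 0)).1).sum))
include hpm

/-- **The `ι`-refined Hilbert function of the Jacobian ring is the line's fold**: for a nonsingular
`ι`-invariant quinary form of even degree `d ≥ 2`,
`dim (S_t)_{(−1)^j} − dim ((J_f)_t)_{(−1)^j}` is entry `t` (component `j`) of `T·T·F·F·F`.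
[cite: CarlsonMullerStachPeters2017, §7.4 Thm. 7.4.1] -/
theorem hilbertSign_jacobianIdeal_signInvolution_eq (fc : ℕ → Bool → List (ℕ × ℕ))
    (hfc : ∀ d p, fc d p = (List.range (d - 1)).map fun k => if p ∧ ¬ Even k then (0, 1) else (1, 0))
    {d : ℕ} (hd : Even d) (h2 : 2 ≤ d) {f : MvPolynomial (Fin 5) ℂ} (hf : f.IsHomogeneous d)
    (hns : SmoothHypersurface.IsNonsingularForm ℂ f)
    (ha : (fun i : Fin 5 => if (i : ℕ) < 2 then (-1 : ℂˣ) else 1) ∈ diagonalStabilizer f)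
    {j : ℕ} (hj : j < 2) (t : ℕ) :
    Module.finrank ℂ ↥(homogeneousSubmodule (Fin 5) ℂ t ⊓
        Module.End.eigenspace (aeval (diagonalSubst fun i : Fin 5 => if (i : ℕ) < 2 then (-1 : ℂˣ) else 1)).toLinearMap
          ((-1 : ℂ) ^ j)) -
      Module.finrank ℂ ↥(idealDegree (UniversalHypersurface.jacobianIdeal (N := 4) f) t ⊓
        Module.End.eigenspace (aeval (diagonalSubst fun i : Fin 5 => if (i : ℕ) < 2 then (-1 : ℂˣ) else 1)).toLinearMap
          ((-1 : ℂ) ^ j)) =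
      if j = 0 then ((pm (pm (pm (pm (fc d true) (fc d true)) (fc d false)) (fc d false)) (fc d false)).getD t (0, 0)).1
      else ((pm (pm (pm (pm (fc d true) (fc d true)) (fc d false)) (fc d false)) (fc d false)).getD t (0, 0)).2 := by
  obtain ⟨M, hXM⟩ := exists_X_pow_mem_jacobianIdeal hf (by omega) hns
  have had : ∀ i, ((((fun i : Fin 5 => if (i : ℕ) < 2 then (-1 : ℂˣ) else 1) i : ℂˣ) : ℂ)) ^ d = 1 := by
    intro i
    dsimp only
    split_ifs
    · rw [Units.val_neg, Units.val_one, hd.neg_one_pow]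
    · rw [Units.val_one, one_pow]
  have hc : (-1 : ℂ) ^ j = 1 ∨ (-1 : ℂ) ^ j = -1 := by
    obtain rfl | rfl : j = 0 ∨ j = 1 := by omega
    · exact Or.inl (pow_zero _)
    · exact Or.inr (pow_one _)
  rw [hilbertSign_jacobianIdeal_eq_card (n := 3) hf h2 (signUnits_mul_self 2) ha had hXM hc]
  have hfilt : (((univ : Finset (Fin 5)).finsuppAntidiag t).filter
      fun β : Fin 5 →₀ ℕ ↦ (∀ i, β i ≤ d - 2) ∧
        (∏ i, (((fun i : Fin 5 => if (i : ℕ) < 2 then (-1 : ℂˣ) else 1) i : ℂˣ) : ℂ) ^ β i) = (-1) ^ j) =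
      ((univ : Finset (Fin 5)).finsuppAntidiag t).filter
        fun β : Fin 5 →₀ ℕ ↦ (∀ i, β i ≤ d - 2) ∧ (j = 0 ↔ Even (β 0 + β 1)) :=
    filter_congr fun β _ ↦ by rw [← signInvolutionVector_eq, prod_signInvolutionVector_pow_eq_iff β hj]
  rw [hfilt, card_box_parity_eq d _ h2 (fun m ↦ (j = 0 ↔ Even m)), fold5_getD_eq_card pm hpm fc hfc d t]
  obtain rfl | rfl : j = 0 ∨ j = 1 := by omega
  · simp only [if_true, true_iff]
  · simp only [one_ne_zero, if_false, false_iff]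

end Kernel

/-- **`stub_signDeckHodge` from the kernel form** `Griffiths1969_residueKernel_eq_jacobianIdeal` of the
Griffiths–Voisin residue theorem (otherwise the registered v6 signature verbatim): the eigen-Hodge
numbers of `ι` on `H^{3−q,q}(X_f)` are `shn d j q`. Uses the tree's PROVED odd-dimensional dimension
statement `finrank_signEigenspace_inf_piece_eq_of_residueKernel` and the vanishing
`finrank_signEigenspace_inf_piece_eq_zero_of_lt`, then §1–§3.
[cite: VoisinHodgeII2003, §6.1.3 Thm. 6.10 and Cor. 6.12 (held text chunks p0159, p0161)]
[cite: CarlsonMullerStachPeters2017, §7.4 Thm. 7.4.1] -/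
theorem stub_signDeckHodge_of_residueKernel :
    open Literature.AlgebraicGeometry.Motives Literature.AlgebraicGeometry.HodgeTheory Literature.AlgebraicGeometry.HodgeTheory.BettiUniverse CategoryTheory.Limits in let pmul2 : List (ℕ × ℕ) → List (ℕ × ℕ) → List (ℕ × ℕ) := fun a b => (List.range (a.length + b.length - 1)).map fun k => (((List.range (k + 1)).map fun i => (a.getD i (0, 0)).1 * (b.getD (k - i) (0, 0)).1 + (a.getD i (0, 0)).2 * (b.getD (k - i) (0, 0)).2).sum, ((List.range (k + 1)).map fun i => (a.getD i (0, 0)).1 * (b.getD (k - i) (0, 0)).2 + (a.getD i (0, 0)).2 * (b.getD (k - i) (0, 0)).1).sum); let fac : ℕ → Bool → List (ℕ × ℕ) := fun d odd => (List.range (d - 1)).map fun k => if odd ∧ ¬ Even k then (0, 1) else (1, 0); let shn : ℕ → ℕ → ℕ → ℕ := fun d j q => if (q + 1) * d < 5 then 0 else if j = 0 then (([fac d true, fac d false, fac d false, fac d false].foldl pmul2 (fac d true)).getD ((q + 1) * d - 5) (0, 0)).1 else (([fac d true, fac d false, fac d false, fac d false].foldl pmul2 (fac d true)).getD ((q + 1)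 * d - 5) (0, 0)).2; Griffiths1969_residueKernel_eq_jacobianIdeal → ∀ ⦃d : ℕ⦄, Even d → 4 ≤ d → ∀ f : MvPolynomial (Fin 5) ℂ, f.IsHomogeneous d → (∀ e : Fin 5 →₀ ℕ, ¬ Even (e 0 + e 1) → f.coeff e = 0) → SmoothHypersurface.IsNonsingularForm ℂ f → ∀ (hXF : IsSmoothProjective 3 (SmoothHypersurface.hypersurface f)) (ha : (fun i : Fin 5 => if (i : ℕ) < 2 then (-1 : ℂˣ) else 1) ∈ diagonalStabilizer f), ∀ j q : ℕ, j < 2 → q ≤ 3 → Module.finrank ℂ ↥(Module.End.eigenspace ((pull (diagonalAut f ha) 3).baseChange ℂ) ((-1 : ℂ) ^ j) ⊓ (hodge exists_isReal_hodgeModel_holds hXF 3).piece ((3 : ℤ) - q) q) = shn d j q := by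
  intro pmul2 fac shn hG d hd h4 f hf hcoef hns hXF ha j q hj hq
  have hpm : ∀ a b, pmul2 a b = (List.range (a.length + b.length - 1)).map fun k =>
      (((List.range (k + 1)).map fun i =>
          (a.getD i (0, 0)).1 * (b.getD (k - i) (0, 0)).1 + (a.getD i (0, 0)).2 * (b.getD (k - i) (0, 0)).2).sum,
       ((List.range (k + 1)).map fun i =>
          (a.getD i (0, 0)).1 * (b.getD (k - i) (0, 0)).2 + (a.getD i (0, 0)).2 * (b.getD (k - i) (0, 0)).1).sum) :=
    fun a b ↦ rfl
  have hfc : ∀ d p, fac d p = (List.range (d - 1)).map fun k => if p ∧ ¬ Even k then (0, 1) else (1, 0) :=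
    fun d p ↦ rfl
  change _ = if (q + 1) * d < 5 then 0 else if j = 0 then
      ((pmul2 (pmul2 (pmul2 (pmul2 (fac d true) (fac d true)) (fac d false)) (fac d false)) (fac d false)).getD
        ((q + 1) * d - 5) (0, 0)).1 else
      ((pmul2 (pmul2 (pmul2 (pmul2 (fac d true) (fac d true)) (fac d false)) (fac d false)) (fac d false)).getD
        ((q + 1) * d - 5) (0, 0)).2
  by_cases hlt : (q + 1) * d < 5
  · rw [if_pos hlt]
    exact finrank_signEigenspace_inf_piece_eq_zero_of_lt
      (Griffiths1969_residues_span_hodgeFiltration_of_residueKernel hG) exists_isReal_hodgeModel_holds f hf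
      hns hXF ha j hq hlt
  rw [if_neg hlt, finrank_signEigenspace_inf_piece_eq_of_residueKernel hG exists_isReal_hodgeModel_holds
    hodgePQ_independent_of_hodgeModel_holds f hf hns hXF ha j hq (k := (q + 1) * d - 5) (by omega),
    twistedDiagonalAction_signInvolutionVector, signInvolutionVector_eq,
    inf_comm (Module.End.eigenspace _ _) (homogeneousSubmodule _ _ _),
    inf_comm (Module.End.eigenspace _ _) (idealDegree _ _)]
  exact hilbertSign_jacobianIdeal_signInvolution_eq pmul2 hpm fac hfc hd (by omega) hf hns ha hj _

end Summit.HodgeConjecture.HodgeConjecture.Theorems.SignSymmetricPowersSignDeckHodgeKernel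

end
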